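import Mathlib
import Summits.HodgeConjecture.FermatCycles.HodgeFermatPropL7cA

/-!
# PROPOSITION L7(c) — part 2: `propL7c`, `theoremD6_of_U` (`HodgeFermat/PropL7c.lean`; HF-G22)

Tree copy (part 2 of 2) of the module `HodgeFermat/PropL7c.lean` of the sibling cell's standalone package
`run/shared/lean/pub/pub-hodgefermat/lean/HodgeFermat/` (394 lines, sha256 `20a93779212bc544…`), source lines 284–394 (§3: PROPOSITION L7(c) `propL7c`, THEOREM D6 modulo THEOREM U `theoremD6_of_U`).
Filed by cell `pub-hfermat`, seat prover-1 gen-3, on the COORDINATOR KEEPER RULING of 2026-08-25 (gem sweep H1: take the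
off-gate kernel theorem `thmFstar` through the gate) — here THEOREM F* of `tables/DPRIME-THEOREM.md` §9 IN FULL, i.e.
PROPOSITION D′(3N) and the descent (`HodgeFermat/PropDPrimeNFinal.lean`, GATE HF-G34), the last off-gate form of THEOREM F*
(its first two forms, `DecodingFinal.thmFstar` = F* at the prime levels and `ThmFstarNFinal.thmFstar` = F*(3N), landed on
2026-08-25 as `HodgeFermatThmFstar.lean` / `HodgeFermatThmFstarN.lean`, seats prover-1 gen-0 / gen-2); this file is one link of
the import closure of `PropDPrimeNFinal.propDprime` (the sibling's KR-free chain: THEOREM L, COROLLARY M, THEOREM D6,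
THEOREM U⁺, THEOREM KR6, THEOREM Z3U) on top of those landed chains.  The source module is the sibling's hub-checked module of
record (pub-hodgefermat `CERT.md` l.885, GATE HF-G22; cell record `check/PropL7c_standalone.lean` sha256 `1d93c4be2d9b15f4…`); its declarations are copied VERBATIM.
Deviations from the source module, exhaustively: the `import` lines (tree modules `Summits.HodgeConjecture.FermatCycles.
HodgeFermat*` instead of `HodgeFermat.*`); this module docstring; the `set_option`/namespace/`open` preamble (source l.38–43) and part 1's four re-binding `open` lines are repeated at the top because the module is split. The module docstring is quoted in full in part 1.
Every other line — in particular every declaration's statement and proof — is byte-identical to the source.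
HONEST FRAMING: explicit algebraic cycles for specific Hodge classes on Fermat/Delsarte varieties; residual open instances
listed; no claim on general Hodge.  (This file is arithmetic of CM types / finite combinatorics / analytic number theory
of the sibling's KR-free programme; it claims nothing about cycles.)
-/

set_option autoImplicit false

namespace HodgeFermat.KRFree.PropL7c

open HodgeFermat.KRFree HodgeFermat.KRFree.LemmaN HodgeFermat.KRFree.LemmaO HodgeFermat.KRFree.TheoremL
  HodgeFermat.KRFree.Bridge HodgeFermat.KRFree.TheoremD6
open HodgeFermat.KRFree.Decoding renaming st_symm → sameType_symm, st_trans → sameType_trans, st_swap → sameType_swap, st_rot → sameType_rot, unit_mul_not_dvd → not_dvd_unit_mul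
open HodgeFermat.KRFree.Decoding (rsum_swap rsum_rot)
open HodgeFermat.KRFree.TheoremZ3U renaming not_dvd_cofactor' → not_dvd_cofactor, rsum_const₃ → rsum_const_of_dvd
open HodgeFermat.KRFree.TheoremZ3U renaming res_neg' → res_neg, rsum_neg' → rsum_neg, coprime_neg' → coprime_neg

/-! ## §3  PROPOSITION L7(c), and THEOREM D6 modulo THEOREM U -/

/-- **PROPOSITION L7(c)** (`tables/KR-FREE.md` §3): at a squarefree level `7n` prime to 6, a disjoint jointly
primitive (Z1, Z1) pair at 7 does not have equal CM types.  Unconditional (LEMMA CC is not used). -/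
theorem propL7c : PropL7c := by
  intro n y x₂ x₃ y' x₂' x₃' hsq h7n h3 hodd hs hx₂ hx₃ hy hs' hx₂' hx₃' hy' hjp hdisj hH
  have hp : (7).Prime := by norm_num
  have hn : 0 < n := hodd.pos
  have h7cop : Nat.Coprime 7 n := (Nat.Prime.coprime_iff_not_dvd hp).mpr h7n
  -- y ≢ y' (mod n), from disjointness
  have hyy' : ¬ y ≡ y' [MOD n] := fun h => hdisj.1.1 (h.mul_left' 7)
  -- the (Z1,Z1) row at 7 with 3 ∤ n: n = 5g, g = gcd(y − y', n), y − y' ≡ g v, 5 ∤ v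
  have hrow := row_Z1Z1_seven_not3 n y x₂ x₃ y' x₂' x₃' h7n hn hodd h3 hs hx₂ hx₃ hs' hx₂' hx₃' hyy' hH
  obtain ⟨g, hg⟩ : ∃ g, Nat.gcd (y + (n - 1) * y') n = g := ⟨_, rfl⟩
  have hgpos : 0 < Nat.gcd (y + (n - 1) * y') n := Nat.gcd_pos_of_pos_right _ hn
  have hcop := Nat.coprime_div_gcd_div_gcd hgpos
  rw [hg] at hrow hcop hgpos
  rw [hrow] at hcop
  have hgn : g ∣ n := hg ▸ Nat.gcd_dvd_right _ _
  have hgz : g ∣ y + (n - 1) * y' := hg ▸ Nat.gcd_dvd_left _ _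
  have hn5 : n = 5 * g := by
    have h := Nat.div_mul_cancel hgn
    rw [hrow] at h
    omega
  obtain ⟨v, hzv⟩ := hgz
  rw [hzv, Nat.mul_div_cancel_left v hgpos] at hcop
  -- hcop : Nat.Coprime v 5
  have h5g : ¬ 5 ∣ g := not_dvd_cofactor (by norm_num) (hn5 ▸ hsq)
  have hsn : n ∣ 7 * y + x₂ + x₃ := dvd_of_level hs
  -- §2: T̄ has no zero entry and the CM type of V = g·(3v, 3v, 9v) at level n
  obtain ⟨nz₂, nz₃, hT⟩ := Z1Z1_seven_type n g v y x₂ x₃ y' x₂' x₃' h7n hn hs hx₂ hx₃ hs' hx₂' hx₃' hy hy'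
    hn5 hzv hcop hH
  have nz₁ : ¬ n ∣ 7 * y := not_dvd_unit_mul h7cop hy
  subst hn5
  by_cases hg1 : g = 1
  · -- N = 35: F35
    subst hg1
    have e35 : 7 * (5 * 1) = 35 := by norm_num
    rw [e35] at hs hs' hH hdisj
    have h₁ : ¬ 35 ∣ 7 * y := fun h => hy (Nat.dvd_of_mul_dvd_mul_left (by norm_num : 0 < 7)
      (by simpa using h))
    have h₁' : ¬ 35 ∣ 7 * y' := fun h => hy' (Nat.dvd_of_mul_dvd_mul_left (by norm_num : 0 < 7)
      (by simpa using h))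
    have h₂ : ¬ 35 ∣ x₂ := fun h => hx₂ (Nat.dvd_trans ⟨5, by norm_num⟩ h)
    have h₃ : ¬ 35 ∣ x₃ := fun h => hx₃ (Nat.dvd_trans ⟨5, by norm_num⟩ h)
    have h₂' : ¬ 35 ∣ x₂' := fun h => hx₂' (Nat.dvd_trans ⟨5, by norm_num⟩ h)
    have h₃' : ¬ 35 ∣ x₃' := fun h => hx₃' (Nat.dvd_trans ⟨5, by norm_num⟩ h)
    rcases coincidenceFree_first F35 (by norm_num) (7 * y) x₂ x₃ (7 * y') x₂' x₃' hs hs' h₁ h₂ h₃ h₁' h₂'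
      h₃' hH with h | h | h
    · exact hdisj.1.1 h
    · exact hx₂' (by omega)
    · exact hx₃' (by omega)
  · -- g > 1: a prime q of g; q ≠ 5 (squarefree), q ≠ 2, 3 (N prime to 6), q ≠ 7 (7 ∤ n): q ≥ 11
    obtain ⟨q, hq, hqg⟩ := Nat.exists_prime_and_dvd hg1
    have hqn : q ∣ 5 * g := Nat.dvd_trans hqg (dvd_mul_left g 5)
    have hq5 : q ≠ 5 := fun h => h5g (h ▸ hqg)
    have h7q : 7 ≤ q := seven_le_prime hq hqn hodd h3 hq5
    have hq7 : ¬ q ∣ 7 := by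
      intro h
      have := (Nat.prime_dvd_prime_iff_eq hq (by norm_num)).mp h
      subst this
      exact h7n hqn
    obtain ⟨g', rfl⟩ := hqg
    have hsq' : Squarefree (q * (5 * g')) := by rwa [show q * (5 * g') = 5 * (q * g') by ring]
    have hq5g' : ¬ q ∣ 5 * g' := not_dvd_cofactor hq hsq'
    have hg'0 : 0 < 5 * g' := by have := pos_right hgpos; omega
    have hodd5 : Odd (5 * g') := by
      rw [show 5 * (q * g') = q * (5 * g') by ring] at hodd
      exact (Nat.odd_mul.mp hodd).2
    by_cases hZ3 : q ∣ 7 * y ∧ q ∣ x₂ ∧ q ∣ x₃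
    · -- T is a Z3 triple at q at level 7n, T' is not (joint primitivity): `z3_vs_any` at level 7n
      obtain ⟨hd₁, hd₂, hd₃⟩ := hZ3
      have hqy : q ∣ y := ((Nat.Prime.dvd_mul hq).mp hd₁).resolve_left hq7
      obtain ⟨a, rfl⟩ := hqy
      obtain ⟨b, rfl⟩ := hd₂
      obtain ⟨c, rfl⟩ := hd₃
      have hqN' : ¬ q ∣ 7 * (5 * g') := fun h => ((Nat.Prime.dvd_mul hq).mp h).elim hq7 hq5g'
      have hN' : 0 < 7 * (5 * g') := by omega
      have hodd' : Odd (7 * (5 * g')) := Nat.odd_mul.mpr ⟨⟨3, rfl⟩, hodd5⟩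
      have elevel : q * (7 * (5 * g')) = 7 * (5 * (q * g')) := by ring
      have hs'' : q * (7 * (5 * g')) ∣ 7 * y' + x₂' + x₃' := by rw [elevel]; exact hs'
      have hq7n : q ∣ 7 * (5 * (q * g')) := ⟨7 * (5 * g'), by ring⟩
      have hne : ¬ (q ∣ 7 * y' ∧ q ∣ x₂' ∧ q ∣ x₃') := fun ⟨d1, d2, d3⟩ =>
        hjp q hq hq7n ⟨7 * a, by ring⟩ (dvd_mul_right q b) (dvd_mul_right q c) d1 d2 d3
      have hu : ¬ q * (7 * (5 * g')) ∣ 7 * y' := fun h =>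
        hy' (Nat.dvd_of_mul_dvd_mul_left (by norm_num : 0 < 7) (by rw [elevel] at h; exact h))
      have hv : ¬ q * (7 * (5 * g')) ∣ x₂' := fun h => hx₂' (Nat.dvd_trans ⟨q * (5 * g'), by ring⟩ h)
      have hw : ¬ q * (7 * (5 * g')) ∣ x₃' := fun h => hx₃' (Nat.dvd_trans ⟨q * (5 * g'), by ring⟩ h)
      have hH' : SameType (q * (7 * (5 * g'))) (q * (7 * a), q * b, q * c) (7 * y', x₂', x₃') := by
        rw [elevel, show q * (7 * a) = 7 * (q * a) by ring]; exact hH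
      exact z3_vs_any q (7 * (5 * g')) (7 * a) b c (7 * y') x₂' x₃' hq h7q hqN' hN' hodd' hs'' hne hu hv hw hH'
    · -- V is a Z3 triple at q at level n = q·(5g'), T̄ ∼ V is not: `z3_vs_any` at level n
      have elevel : q * (5 * g') = 5 * (q * g') := by ring
      have hsum : q * (5 * g') ∣ 7 * y + x₂ + x₃ := by rw [elevel]; exact hsn
      have hu : ¬ q * (5 * g') ∣ 7 * y := by rw [elevel]; exact nz₁
      have hv : ¬ q * (5 * g') ∣ x₂ := by rw [elevel]; exact nz₂
      have hw : ¬ q * (5 * g') ∣ x₃ := by rw [elevel]; exact nz₃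
      have hH' : SameType (q * (5 * g')) (q * (g' * (3 * v)), q * (g' * (3 * v)), q * (g' * (9 * v)))
          (7 * y, x₂, x₃) := by
        rw [elevel, show q * (g' * (3 * v)) = q * g' * (3 * v) by ring,
          show q * (g' * (9 * v)) = q * g' * (9 * v) by ring]
        exact sameType_symm hT
      exact z3_vs_any q (5 * g') (g' * (3 * v)) (g' * (3 * v)) (g' * (9 * v)) (7 * y) x₂ x₃ hq h7q hq5g'
        hg'0 hodd5 hsum hZ3 hu hv hw hH'

/-- **THEOREM D6 modulo THEOREM U**: no disjoint coincidence of CM types at a squarefree level prime to 6, given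
THEOREM U (`tables/SEMI-THEOREM.md` §2, the all-unit case, in the form `ThmU`). -/
theorem theoremD6_of_U (hU : ThmU) : D6 :=
  theoremD6_of propL7c hU

end HodgeFermat.KRFree.PropL7c
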